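import Summits.ValiantsHypothesis.ValiantsHypothesis.Theorems.LacunarySymmetroidMatrixDescartesPivotRankOneCriticalWindowsLoneFoldCubic
import Summits.ValiantsHypothesis.ValiantsHypothesis.Theorems.LacunarySymmetroidMatrixDescartesPivotRankOneCriticalWindowsFourFoldAlgebra

/-!
# `MatrixDescartes` census — rank-one `(2,K)₁`, lone letter: WINDOW, MINORS, FOLD DENOMINATOR AND THE `Ξ′`-IDENTITY FOR ANY NUMBER OF LETTERS

HONEST FRAMING.  Object-search cell `pub-symmetroid`, seat `val-sym-mdr-p1` (generation 24); helper file `--supports` the crux item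
stmt-ValiantsHypothesis-18050 (`Theses.LacunarySymmetroid.MatrixDescartes`, OPEN, on HOLD) with NO closure claim.  PURE ALGEBRA at one point, in
the uniform `Finset` currency of `…LoneFoldCubic` (letters `m ∈ s`, rates `βₘ`, positions `tₘ`, point weights `Wₘ`, direction `T`; pivot `p`
with `βₚ < 0`, lone letter `j`): the all-`K` forms of the point-algebra of the `K = 4` files `…FourRequiredWeight` §1 (window), `…FourCramer`
(minor signs, `j`-free combination), `…FourFoldAlgebra` §2–§3 (`Ξ′`-identity, fold denominator `𝒟 > 0`).  Nothing here is a count; nothing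
bears on `MatrixDescartes` in its window, on `DoorA26`/`DoorA34`, registers / credences, or `VP ≠ VNP`.

* §1 `window_of_critical` — at a critical point ((E1) `∑Wₘ(T²−tₘ²) = 0`, (E2) `∑βₘWₘ(T−tₘ)² = 0`) with `T > tₘ` for every `m ≠ j` and at
  least one letter besides `p, j`: `T < tⱼ` and the STRICT window inequality `βⱼ(T+tₚ)(tⱼ−T) < (−βₚ)(T−tₚ)(tⱼ+T)` (signed identity
  `∑ Wₘ(T−tₘ)Δₘ = −βₚ(T−tₚ)·(E1) + (T+tₚ)·(E2)`, every non-`j` term `≥ 0`, the left terms `> 0`).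
* §2 the `j`-minors `Nₘ := βⱼ(T−tⱼ)²(T²−tₘ²) − (T²−tⱼ²)βₘ(T−tₘ)²`: `Nⱼ = 0`; `Nₘ > 0` for a letter below the direction with positive rate;
  `Nₚ = (T−tₚ)(tⱼ−T)·[βⱼ(tⱼ−T)(T+tₚ) + βₚ(T+tⱼ)(T−tₚ)] < 0` exactly by the window inequality; and the `j`-FREE COMBINATION
  `∑WₘNₘ = βⱼ(T−tⱼ)²·(E1) − (T²−tⱼ²)·(E2)`.
* §3 `foldDenominator_eq/_pos` — `𝒟 := βⱼ(T−tⱼ)²·S_{βg} + (tⱼ²−T²)·S₂ = ∑ βₘWₘNₘ > 0` on the window (pivot term `βₚWₚNₚ > 0`, left terms `> 0`,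
  lone term `0`).
* §4 `coupled_sum` (`∑(κ+λβₘ)Wₘfₘ = κ∑Wf + λ∑βWf`), `sum_update_mul` (a sum with the `j`-weight replaced), and the **`Ξ′`-IDENTITY**
  `xiDeriv_identity`: the two differentiated critical equations `(λS_{βg})q + Aⱼξ = −2T·A`, `(λS₂)q + βⱼuⱼ²·ξ = −2S₁` together with (E2) give
  `ξ·λ·𝒟 = −2Tλ·𝒥`, `𝒥 = 2S₁² − A·S₂` — so along a critical branch the lone weight is stationary exactly at the fold points.
[folklore] Polynomial identities summed over a `Finset`, sign bookkeeping, Cramer's rule for a 2 × 2 system.  No definitions, no named facts.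
-/

-- `Summit.ValiantsHypothesis.ValiantsHypothesis.…` repeats a component by the D-0017 layout
-- (single-conjunct summit), which the `dupNamespace` linter flags; the name is mandated.
set_option linter.dupNamespace false

namespace Summit.ValiantsHypothesis.ValiantsHypothesis.Theorems.LacunarySymmetroidMatrixDescartes.Pivot.CriticalWindows.Lone

open Finset
open scoped BigOperators

/-! ## 1. The window of a critical direction beyond the pivot -/

/-- **SIGNED IDENTITY.**  `∑ Wₘ(T−tₘ)·[−βₚ(T−tₚ)(T+tₘ) + βₘ(T+tₚ)(T−tₘ)] = −βₚ(T−tₚ)·∑Wₘ(T²−tₘ²) + (T+tₚ)·∑βₘWₘ(T−tₘ)²`. [folklore] -/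
theorem signed_identity {ι : Type*} (s : Finset ι) (β t W : ι → ℝ) (T : ℝ) (p : ι) :
    ∑ m ∈ s, W m * (T - t m) * (-β p * (T - t p) * (T + t m) + β m * (T + t p) * (T - t m))
      = -β p * (T - t p) * (∑ m ∈ s, W m * (T ^ 2 - t m ^ 2)) + (T + t p) * ∑ m ∈ s, β m * W m * (T - t m) ^ 2 := by
  rw [Finset.mul_sum, Finset.mul_sum, ← Finset.sum_add_distrib]
  exact Finset.sum_congr rfl fun m _ => by ring

/-- **THE WINDOW OF A CRITICAL DIRECTION (any number of letters).**  Positive weights; pivot `p ∈ s` with `βₚ < 0`, `0 < βₘ` for `m ≠ p`;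
positions `tₘ > 0`, and `tₘ < T` for every `m ≠ j` (in particular `tₚ < T`); at least one letter besides `p` and `j`.  If (E1), (E2) hold
at `T` then `T < tⱼ` and `βⱼ(T+tₚ)(tⱼ−T) < (−βₚ)(T−tₚ)(tⱼ+T)`. [folklore] -/
theorem window_of_critical {ι : Type*} (s : Finset ι) (β t W : ι → ℝ) (T : ℝ) (p j : ι)
    (hp : p ∈ s) (hj : j ∈ s) (hpj : p ≠ j) (hleft : ∃ m ∈ s, m ≠ p ∧ m ≠ j)
    (hW : ∀ m ∈ s, 0 < W m) (hβp : β p < 0) (hβ : ∀ m ∈ s, m ≠ p → 0 < β m)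
    (ht : ∀ m ∈ s, 0 < t m) (hlt : ∀ m ∈ s, m ≠ j → t m < T)
    (h1 : ∑ m ∈ s, W m * (T ^ 2 - t m ^ 2) = 0) (h2 : ∑ m ∈ s, β m * W m * (T - t m) ^ 2 = 0) :
    T < t j ∧ β j * (T + t p) * (t j - T) < (-β p) * (T - t p) * (t j + T) := by
  have hid := signed_identity s β t W T p
  rw [h1, h2, mul_zero, mul_zero, add_zero] at hid
  obtain ⟨m₀, hm₀, hm₀p, hm₀j⟩ := hleft
  have htp : t p < T := hlt p hp hpj
  have ht0 : 0 < t p := ht p hp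
  have hβj : 0 < β j := hβ j hj hpj.symm
  -- every term with `m ≠ j` is `≥ 0`; the left terms are `> 0`
  have hpos : ∀ m ∈ s, m ≠ p → m ≠ j →
      0 < W m * (T - t m) * (-β p * (T - t p) * (T + t m) + β m * (T + t p) * (T - t m)) := by
    intro m hm hmp hmj
    have hu : 0 < T - t m := by linarith [hlt m hm hmj]
    have h0 := ht m hm
    have t1 : 0 < -β p * (T - t p) * (T + t m) := mul_pos (mul_pos (by linarith) (by linarith)) (by linarith)
    have t2 : 0 < β m * (T + t p) * (T - t m) := mul_pos (mul_pos (hβ m hm hmp) (by linarith)) hu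
    exact mul_pos (mul_pos (hW m hm) hu) (by linarith)
  have hnonneg : ∀ m ∈ s, m ≠ j → 0 ≤ W m * (T - t m) * (-β p * (T - t p) * (T + t m) + β m * (T + t p) * (T - t m)) := by
    intro m hm hmj
    by_cases hmp : m = p
    · rw [hmp]
      have e : W p * (T - t p) * (-β p * (T - t p) * (T + t p) + β p * (T + t p) * (T - t p)) = 0 := by ring
      rw [e]
    · exact (hpos m hm hmp hmj).le
  -- hence the `j`-term is `< 0`
  have hjneg : W j * (T - t j) * (-β p * (T - t p) * (T + t j) + β j * (T + t p) * (T - t j)) < 0 := by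
    by_contra hcon
    push Not at hcon
    have hall : ∀ m ∈ s, 0 ≤ W m * (T - t m) * (-β p * (T - t p) * (T + t m) + β m * (T + t p) * (T - t m)) := by
      intro m hm
      by_cases hmj : m = j
      · rw [hmj]; exact hcon
      · exact hnonneg m hm hmj
    have hzero := (Finset.sum_eq_zero_iff_of_nonneg hall).1 hid m₀ hm₀
    exact absurd hzero (ne_of_gt (hpos m₀ hm₀ hm₀p hm₀j))
  -- so `T < tⱼ` …
  have hTj : T < t j := by
    by_contra hcon
    push Not at hcon
    have hu : 0 ≤ T - t j := by linarith
    have hΔ : 0 ≤ -β p * (T - t p) * (T + t j) + β j * (T + t p) * (T - t j) := by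
      have t1 : 0 ≤ -β p * (T - t p) * (T + t j) :=
        mul_nonneg (mul_nonneg (by linarith) (by linarith)) (by linarith [ht j hj])
      have t2 : 0 ≤ β j * (T + t p) * (T - t j) := mul_nonneg (mul_nonneg hβj.le (by linarith)) hu
      linarith
    have := mul_nonneg (mul_nonneg (hW j hj).le hu) hΔ
    linarith
  refine ⟨hTj, ?_⟩
  -- … and the bracket is positive
  have hu : T - t j < 0 := by linarith
  have hWu : W j * (T - t j) < 0 := mul_neg_of_pos_of_neg (hW j hj) hu
  have hΔ : 0 < -β p * (T - t p) * (T + t j) + β j * (T + t p) * (T - t j) := by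
    by_contra hcon
    push Not at hcon
    have := mul_nonneg_of_nonpos_of_nonpos hWu.le hcon
    linarith
  nlinarith [hΔ]

/-! ## 2. The `j`-minors -/

/-- `Nⱼ = 0`. [folklore] -/
theorem minorN_lone {ι : Type*} (β t : ι → ℝ) (T : ℝ) (j : ι) :
    β j * (T - t j) ^ 2 * (T ^ 2 - t j ^ 2) - (T ^ 2 - t j ^ 2) * β j * (T - t j) ^ 2 = 0 := by
  ring

/-- `Nₘ > 0` for a letter with positive rate at `0 < tₘ < T < tⱼ` (and `βⱼ > 0`). [folklore] -/
theorem minorN_pos {βm βj tm tj T : ℝ} (hβm : 0 < βm) (hβj : 0 < βj) (htm : 0 < tm) (hmT : tm < T) (hTj : T < tj) :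
    0 < βj * (T - tj) ^ 2 * (T ^ 2 - tm ^ 2) - (T ^ 2 - tj ^ 2) * βm * (T - tm) ^ 2 := by
  have hA : 0 < T ^ 2 - tm ^ 2 := by nlinarith
  have hAj : T ^ 2 - tj ^ 2 < 0 := by nlinarith
  have h1 : 0 < βj * (T - tj) ^ 2 * (T ^ 2 - tm ^ 2) := mul_pos (mul_pos hβj (by nlinarith)) hA
  have h2 : (T ^ 2 - tj ^ 2) * βm * (T - tm) ^ 2 < 0 := mul_neg_of_neg_of_pos (mul_neg_of_neg_of_pos hAj hβm) (by nlinarith)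
  linarith

/-- `Nₚ = (T−tₚ)(tⱼ−T)·[βⱼ(tⱼ−T)(T+tₚ) + βₚ(T+tⱼ)(T−tₚ)]`. [folklore] -/
theorem minorN_pivot_factor (βp βj tp tj T : ℝ) :
    βj * (T - tj) ^ 2 * (T ^ 2 - tp ^ 2) - (T ^ 2 - tj ^ 2) * βp * (T - tp) ^ 2
      = (T - tp) * (tj - T) * (βj * (tj - T) * (T + tp) + βp * (T + tj) * (T - tp)) := by
  ring

/-- `Nₚ < 0` on the window: `tₚ < T < tⱼ` and `βⱼ(T+tₚ)(tⱼ−T) < (−βₚ)(T−tₚ)(tⱼ+T)`. [folklore] -/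
theorem minorN_pivot_neg {βp βj tp tj T : ℝ} (hpT : tp < T) (hTj : T < tj)
    (hwin : βj * (T + tp) * (tj - T) < (-βp) * (T - tp) * (tj + T)) :
    βj * (T - tj) ^ 2 * (T ^ 2 - tp ^ 2) - (T ^ 2 - tj ^ 2) * βp * (T - tp) ^ 2 < 0 := by
  rw [minorN_pivot_factor]
  have hb : βj * (tj - T) * (T + tp) + βp * (T + tj) * (T - tp) < 0 := by nlinarith
  exact mul_neg_of_pos_of_neg (mul_pos (by linarith) (by linarith)) hb

/-- **THE `j`-FREE COMBINATION.**  `∑ WₘNₘ = βⱼ(T−tⱼ)²·∑Wₘ(T²−tₘ²) − (T²−tⱼ²)·∑βₘWₘ(T−tₘ)²` for ANY weights. [folklore] -/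
theorem jfree_combination {ι : Type*} (s : Finset ι) (β t W : ι → ℝ) (T : ℝ) (j : ι) :
    ∑ m ∈ s, W m * (β j * (T - t j) ^ 2 * (T ^ 2 - t m ^ 2) - (T ^ 2 - t j ^ 2) * β m * (T - t m) ^ 2)
      = β j * (T - t j) ^ 2 * (∑ m ∈ s, W m * (T ^ 2 - t m ^ 2)) - (T ^ 2 - t j ^ 2) * ∑ m ∈ s, β m * W m * (T - t m) ^ 2 := by
  rw [Finset.mul_sum, Finset.mul_sum, ← Finset.sum_sub_distrib]
  exact Finset.sum_congr rfl fun m _ => by ring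

/-- Hence (E2) follows from (E1) and the `j`-free combination when `T² ≠ tⱼ²`. [folklore] -/
theorem critSecond_of_jfree {ι : Type*} (s : Finset ι) (β t W : ι → ℝ) (T : ℝ) (j : ι) (hAj : T ^ 2 - t j ^ 2 ≠ 0)
    (hF : ∑ m ∈ s, W m * (β j * (T - t j) ^ 2 * (T ^ 2 - t m ^ 2) - (T ^ 2 - t j ^ 2) * β m * (T - t m) ^ 2) = 0)
    (h1 : ∑ m ∈ s, W m * (T ^ 2 - t m ^ 2) = 0) :
    ∑ m ∈ s, β m * W m * (T - t m) ^ 2 = 0 := by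
  rw [jfree_combination, h1, mul_zero, zero_sub, neg_eq_zero] at hF
  rcases mul_eq_zero.mp hF with h | h
  · exact absurd h hAj
  · exact h

/-! ## 3. The fold denominator -/

/-- **`𝒟 = ∑ βₘWₘNₘ`**: `βⱼ(T−tⱼ)²·∑βW(T²−t²) + (tⱼ²−T²)·∑β²W(T−t)² = ∑ βₘWₘNₘ`. [folklore] -/
theorem foldDenominator_eq {ι : Type*} (s : Finset ι) (β t W : ι → ℝ) (T : ℝ) (j : ι) :
    β j * (T - t j) ^ 2 * (∑ m ∈ s, β m * W m * (T ^ 2 - t m ^ 2)) + (t j ^ 2 - T ^ 2) * ∑ m ∈ s, β m ^ 2 * W m * (T - t m) ^ 2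
      = ∑ m ∈ s, β m * W m * (β j * (T - t j) ^ 2 * (T ^ 2 - t m ^ 2) - (T ^ 2 - t j ^ 2) * β m * (T - t m) ^ 2) := by
  rw [Finset.mul_sum, Finset.mul_sum, ← Finset.sum_add_distrib]
  exact Finset.sum_congr rfl fun m _ => by ring

/-- **`𝒟 > 0` ON THE WINDOW (any number of letters).**  Positive weights, `βₚ < 0 < βₘ` (`m ≠ p`), `0 < tₘ < T` for `m ≠ j`, `T < tⱼ`, and
the window inequality. [folklore] -/
theorem foldDenominator_pos {ι : Type*} (s : Finset ι) (β t W : ι → ℝ) (T : ℝ) (p j : ι)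
    (hp : p ∈ s) (hpj : p ≠ j) (hW : ∀ m ∈ s, 0 < W m) (hβp : β p < 0) (hβ : ∀ m ∈ s, m ≠ p → 0 < β m)
    (ht : ∀ m ∈ s, 0 < t m) (hlt : ∀ m ∈ s, m ≠ j → t m < T) (hTj : T < t j) (hβj : 0 < β j)
    (hwin : β j * (T + t p) * (t j - T) < (-β p) * (T - t p) * (t j + T)) :
    0 < β j * (T - t j) ^ 2 * (∑ m ∈ s, β m * W m * (T ^ 2 - t m ^ 2))
        + (t j ^ 2 - T ^ 2) * ∑ m ∈ s, β m ^ 2 * W m * (T - t m) ^ 2 := by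
  rw [foldDenominator_eq]
  refine Finset.sum_pos' ?_ ⟨p, hp, ?_⟩
  · intro m hm
    by_cases hmj : m = j
    · rw [hmj, minorN_lone]; simp
    · by_cases hmp : m = p
      · rw [hmp]
        exact (mul_pos_of_neg_of_neg (mul_neg_of_neg_of_pos hβp (hW p hp))
          (minorN_pivot_neg (hlt p hp hpj) hTj hwin)).le
      · exact (mul_pos (mul_pos (hβ m hm hmp) (hW m hm))
          (minorN_pos (hβ m hm hmp) hβj (ht m hm) (hlt m hm hmj) hTj)).le
  · exact mul_pos_of_neg_of_neg (mul_neg_of_neg_of_pos hβp (hW p hp)) (minorN_pivot_neg (hlt p hp hpj) hTj hwin)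

/-! ## 4. Coupled sums, the replaced lone weight, and the `Ξ′`-identity -/

/-- **COUPLED SUM.**  `∑(κ+λβₘ)·Wₘ·fₘ = κ·∑Wₘfₘ + λ·∑βₘWₘfₘ`. [folklore] -/
theorem coupled_sum {ι : Type*} (s : Finset ι) (β W f : ι → ℝ) (κ lam : ℝ) :
    ∑ m ∈ s, (κ + lam * β m) * W m * f m = κ * (∑ m ∈ s, W m * f m) + lam * ∑ m ∈ s, β m * W m * f m := by
  rw [Finset.mul_sum, Finset.mul_sum, ← Finset.sum_add_distrib]
  exact Finset.sum_congr rfl fun m _ => by ring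

/-- **A SUM WITH THE LONE WEIGHT REPLACED.**  `∑ (update w j O)ₘ·gₘ = ∑ wₘgₘ + (O − wⱼ)·gⱼ` for `j ∈ s`. [folklore] -/
theorem sum_update_mul {ι : Type*} [DecidableEq ι] (s : Finset ι) (w g : ι → ℝ) (j : ι) (O : ℝ) (hj : j ∈ s) :
    ∑ m ∈ s, Function.update w j O m * g m = (∑ m ∈ s, w m * g m) + (O - w j) * g j := by
  have hterm : ∀ m ∈ s, Function.update w j O m * g m = w m * g m + (if m = j then (O - w j) * g j else 0) := by
    intro m _
    by_cases hmj : m = j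
    · rw [hmj, Function.update_self, if_pos rfl]; ring
    · rw [Function.update_of_ne hmj, if_neg hmj, add_zero]
  rw [Finset.sum_congr rfl hterm, Finset.sum_add_distrib, Finset.sum_ite_eq' s j, if_pos hj]

/-- **THE `Ξ′`-IDENTITY (any number of letters).**  If (E2) holds and the two differentiated critical equations
`(λ·S_{βg})·q + (T²−tⱼ²)·ξ = −2T·A`, `(λ·S₂)·q + βⱼ(T−tⱼ)²·ξ = −2S₁` hold, then `ξ·λ·𝒟 = −2Tλ·𝒥`. [folklore] -/
theorem xiDeriv_identity {ι : Type*} (s : Finset ι) (β t W : ι → ℝ) (T lam q ξ : ℝ) (j : ι)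
    (h2 : ∑ m ∈ s, β m * W m * (T - t m) ^ 2 = 0)
    (hlin1 : (lam * ∑ m ∈ s, β m * W m * (T ^ 2 - t m ^ 2)) * q + (T ^ 2 - t j ^ 2) * ξ = -(2 * T) * ∑ m ∈ s, W m)
    (hlin2 : (lam * ∑ m ∈ s, β m ^ 2 * W m * (T - t m) ^ 2) * q + (β j * (T - t j) ^ 2) * ξ
      = -2 * ∑ m ∈ s, β m * W m * (T - t m)) :
    ξ * (lam * (β j * (T - t j) ^ 2 * (∑ m ∈ s, β m * W m * (T ^ 2 - t m ^ 2))
        + (t j ^ 2 - T ^ 2) * ∑ m ∈ s, β m ^ 2 * W m * (T - t m) ^ 2))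
      = -(2 * T) * lam * (2 * (∑ m ∈ s, β m * W m * (T - t m)) ^ 2
        - (∑ m ∈ s, W m) * ∑ m ∈ s, β m ^ 2 * W m * (T - t m) ^ 2) := by
  have hSbg := mixedMoment_eq s β t W T
  rw [h2, sub_zero] at hSbg
  have hc := Four.cramer_second_unknown hlin1 hlin2
  rw [hSbg] at hc ⊢
  linear_combination hc

end Summit.ValiantsHypothesis.ValiantsHypothesis.Theorems.LacunarySymmetroidMatrixDescartes.Pivot.CriticalWindows.Lone
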